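import Mathlib.RingTheory.Unramified.LocalRing
import Mathlib.RingTheory.Unramified.Field
import Mathlib.RingTheory.Flat.Localization
import Mathlib.FieldTheory.SeparableDegree
import Literature.RingTheory.HilbertSamuel.FlatBaseChange
import HarnessLib

/-!
# [OURS · L1 W4.2] K2-sep ROUTE A, brick (β) ring core: **the local rings of a SEPARABLE GROUND-FIELD EXTENSION `A ⊗ₖ K` are
# quasi-étale over those of `A`** — for `K/k` separable algebraic of ANY degree and a prime `𝔓 ⊂ A ⊗ₖ K` over `𝔭 ⊂ A`:
# `𝔭 · (A ⊗ₖ K)_𝔓 = 𝔓 · (A ⊗ₖ K)_𝔓`, `(A ⊗ₖ K)_𝔓` is flat over `A_𝔭`, hence (CJS Lemma 2.27 (1)) `H^{(0)}[(A ⊗ₖ K)_𝔓] = H^{(0)}[A_𝔭]`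
# (crux `SigmaMaxModifications` stmt-ResolutionOfSingularities-18506 / conjunct stmt-…-19249; line `w_ladder_rows` v8.5, registered stub
# `stub_isoSepRecurrent`; res-L1-w42-plan-1 WORD 2026-08-27T16:25:47Z «tower base change to k^sep»; design
# `L/res-L1-w42-stub-2/k2sep/K2SEP-DESIGN.md` brick (β))

Prover res-L1-w42-stub-2 (gen 5). Helper file `--supports stmt-ResolutionOfSingularities-19249 --as helper`; commutative algebra over Mathlib and
the tree's `Literature.RingTheory.HilbertSamuel.FlatBaseChange`; no definitions, no named fact. OURS (cell res-hironaka, slot W4.2); NOT statements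
of [Hironaka2017] nor of [CossartJannsenSaito2020]. AI-written; AI review is weaker than expert review.

WHY. Along the base change `X ×_k K → X` of a stage of an isolated point tower (K/k separable algebraic, e.g. `K = k^sep`, INFINITE over k) the
Hilbert–Samuel function must be preserved at EVERY point (so that `(X_K)_max` is the preimage of `X_max` and isolation transfers). The local
rings are `(𝒪_{X,x} ⊗_k K)_𝔓` over `𝒪_{X,x}`-primes; this file is the ring statement. Mathlib's unramified API gives `𝔭 S_𝔮 = 𝔮 S_𝔮` only
for algebras ESSENTIALLY OF FINITE TYPE (`Algebra.isUnramifiedAt_iff_map_eq`), i.e. for FINITE sub-extensions `K₀ ⊆ K`; the infinite case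
is reduced to it element by element (every tensor lives in some `A ⊗ₖ K₀`).

* `map_under_eq_maximalIdeal_of_finiteDimensional` — finite separable `K₀/k`: `𝔭 (A ⊗ K₀)_𝔓 = 𝔪` (Mathlib: `k → K₀` formally unramified,
  base change, `isUnramifiedAt_iff_map_eq`); `algebraMap_map_mem_map_under_of_finiteDimensional` — transported along `K₀ → K`.
* **`map_under_eq_maximalIdeal`** — `K/k` separable algebraic of any degree: `𝔭 · (A ⊗ₖ K)_𝔓 = 𝔪_{(A ⊗ₖ K)_𝔓}`.
* **`flat_localization_tensorProduct`** — `(A ⊗ₖ K)_𝔓` is flat over `A_𝔭` (for the canonical algebra `Localization.AtPrime.algebraOfLiesOver`).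
* **`hilbertFun_localization_tensorProduct_eq`** — `H^{(0)}[(A ⊗ₖ K)_𝔓] = H^{(0)}[A_𝔭]` when `A` and `A ⊗ₖ K` are Noetherian (CJS 2.27 (1)).

[OURS · L1 W4.2; AI-written] [cite: CossartJannsenSaito2020, Lemma 2.27 (1)] [cite: GrothendieckDieudonne1965, Prop. (4.6.1)]
-/

set_option linter.dupNamespace false

noncomputable section

open scoped TensorProduct
open IsLocalRing

namespace Summit.ResolutionOfSingularities.ResolutionOfSingularities.Theorems.SigmaMaxModificationsCorridor3.IsoTailsHS

universe u v w

section Ring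

variable {k : Type u} {K : Type v} {A : Type w} [Field k] [Field K] [Algebra k K] [CommRing A] [Algebra k A]

/-- The map `A ⊗ₖ K₀ → A ⊗ₖ K` induced by a `k`-algebra map `f : K₀ → K` fixes `A ⊗ 1`. [folklore] -/
theorem map_id_tmul_one {K₀ : Type*} [Field K₀] [Algebra k K₀] (f : K₀ →ₐ[k] K) (a : A) :
    Algebra.TensorProduct.map (AlgHom.id k A) f (a ⊗ₜ[k] (1 : K₀)) = a ⊗ₜ[k] (1 : K) := by
  rw [Algebra.TensorProduct.map_tmul, AlgHom.coe_id, id_eq, map_one]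

/-- The pulled-back prime `𝔓₀ = 𝔓 ∩ (A ⊗ₖ K₀)` lies over the same prime of `A`. [folklore] -/
theorem under_comap_map_id {K₀ : Type*} [Field K₀] [Algebra k K₀] (f : K₀ →ₐ[k] K) (𝔓 : Ideal (A ⊗[k] K)) [𝔓.IsPrime] :
    (𝔓.comap (Algebra.TensorProduct.map (AlgHom.id k A) f)).under A = 𝔓.under A := by
  ext a
  simp only [Ideal.under_def, Ideal.mem_comap, Algebra.TensorProduct.algebraMap_apply, Algebra.algebraMap_self,
    RingHom.id_apply]
  rw [map_id_tmul_one]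

/-- **Finite separable extension: `𝔭 · (A ⊗ₖ K₀)_𝔓₀ = 𝔪`** (Mathlib: `k → K₀` is formally unramified, so is the base change
`A → A ⊗ₖ K₀`, which is essentially of finite type; `Algebra.isUnramifiedAt_iff_map_eq`). [cite: GrothendieckDieudonne1965, Prop. (4.6.1)] -/
theorem map_under_eq_maximalIdeal_of_finiteDimensional (K₀ : Type*) [Field K₀] [Algebra k K₀] [Algebra.IsSeparable k K₀]
    [FiniteDimensional k K₀] (𝔓₀ : Ideal (A ⊗[k] K₀)) [𝔓₀.IsPrime] :
    (𝔓₀.under A).map (algebraMap A (Localization.AtPrime 𝔓₀)) = maximalIdeal (Localization.AtPrime 𝔓₀) := by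
  haveI : Algebra.FormallyUnramified k K₀ := .of_isSeparable k K₀
  letI := Localization.AtPrime.algebraOfLiesOver (𝔓₀.under A) 𝔓₀
  haveI : Algebra.IsUnramifiedAt A 𝔓₀ := inferInstance
  exact ((Algebra.isUnramifiedAt_iff_map_eq A (𝔓₀.under A) 𝔓₀).mp inferInstance).2

/-- **The finite step, transported**: for `f : K₀ → K` with `K₀/k` finite separable and `x₀ ∈ A ⊗ₖ K₀` whose image lies in `𝔓`, the image of
`x₀` in `(A ⊗ₖ K)_𝔓` lies in `𝔭 · (A ⊗ₖ K)_𝔓` (the equality `𝔭 (A ⊗ K₀)_𝔓₀ = 𝔓₀ (A ⊗ K₀)_𝔓₀` at `𝔓₀ = 𝔓 ∩ (A ⊗ₖ K₀)` pushed along the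
localization map `(A ⊗ K₀)_𝔓₀ → (A ⊗ K)_𝔓`). [cite: GrothendieckDieudonne1965, Prop. (4.6.1)] -/
theorem algebraMap_map_mem_map_under_of_finiteDimensional {K₀ : Type*} [Field K₀] [Algebra k K₀] [Algebra.IsSeparable k K₀]
    [FiniteDimensional k K₀] (f : K₀ →ₐ[k] K) (𝔓 : Ideal (A ⊗[k] K)) [𝔓.IsPrime] (x₀ : A ⊗[k] K₀)
    (hx : Algebra.TensorProduct.map (AlgHom.id k A) f x₀ ∈ 𝔓) :
    algebraMap (A ⊗[k] K) (Localization.AtPrime 𝔓) (Algebra.TensorProduct.map (AlgHom.id k A) f x₀) ∈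
      (𝔓.under A).map (algebraMap A (Localization.AtPrime 𝔓)) := by
  set ι := Algebra.TensorProduct.map (AlgHom.id k A) f with hι
  let 𝔓₀ : Ideal (A ⊗[k] K₀) := 𝔓.comap ι
  haveI : 𝔓₀.IsPrime := Ideal.IsPrime.comap ι
  have hx₀ : x₀ ∈ 𝔓₀ := hx
  -- the finite case at `𝔓₀`
  have h₀ := map_under_eq_maximalIdeal_of_finiteDimensional (k := k) (A := A) K₀ 𝔓₀
  rw [under_comap_map_id] at h₀
  have hmem₀ : algebraMap (A ⊗[k] K₀) (Localization.AtPrime 𝔓₀) x₀ ∈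
      (𝔓.under A).map (algebraMap A (Localization.AtPrime 𝔓₀)) := by
    rw [h₀, ← Localization.AtPrime.map_eq_maximalIdeal]
    exact Ideal.mem_map_of_mem _ hx₀
  -- carry over along the localization map `(A ⊗ K₀)_𝔓₀ → (A ⊗ K)_𝔓`
  let φ : Localization.AtPrime 𝔓₀ →+* Localization.AtPrime 𝔓 := Localization.localRingHom 𝔓₀ 𝔓 ι.toRingHom rfl
  have hφ := Ideal.mem_map_of_mem φ hmem₀
  rw [Ideal.map_map] at hφ
  have hcomp : φ.comp (algebraMap A (Localization.AtPrime 𝔓₀)) = algebraMap A (Localization.AtPrime 𝔓) := by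
    ext a
    rw [RingHom.comp_apply, IsScalarTower.algebraMap_apply A (A ⊗[k] K₀) (Localization.AtPrime 𝔓₀),
      Localization.localRingHom_to_map, IsScalarTower.algebraMap_apply A (A ⊗[k] K) (Localization.AtPrime 𝔓)]
    congr 1
    exact map_id_tmul_one f a
  have hφx : φ (algebraMap (A ⊗[k] K₀) (Localization.AtPrime 𝔓₀) x₀) = algebraMap (A ⊗[k] K) (Localization.AtPrime 𝔓) (ι x₀) :=
    Localization.localRingHom_to_map _ _ _ _ _
  rwa [hcomp, hφx] at hφ

/-- Every tensor of `A ⊗ₖ K` comes from `A ⊗ₖ K₀` for a finitely generated (hence finite, when `K/k` is algebraic) intermediate field.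
[folklore] -/
theorem exists_intermediateField_fg_preimage [Algebra.IsAlgebraic k K] (x : A ⊗[k] K) :
    ∃ (K₀ : IntermediateField k K) (_ : FiniteDimensional k K₀) (x₀ : A ⊗[k] K₀),
      Algebra.TensorProduct.map (AlgHom.id k A) K₀.val x₀ = x := by
  classical
  obtain ⟨S, rfl⟩ := TensorProduct.exists_finset x
  refine ⟨IntermediateField.adjoin k ((S.image Prod.snd : Finset K) : Set K),
    IntermediateField.finiteDimensional_adjoin fun c _ => Algebra.IsIntegral.isIntegral (R := k) c, ?_⟩
  have hmem : ∀ p ∈ S, p.2 ∈ IntermediateField.adjoin k ((S.image Prod.snd : Finset K) : Set K) := fun p hp =>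
    IntermediateField.subset_adjoin k _ (Finset.mem_coe.mpr (Finset.mem_image_of_mem Prod.snd hp))
  refine ⟨∑ p ∈ S.attach, p.1.1 ⊗ₜ[k] (⟨p.1.2, hmem p.1 p.2⟩ : IntermediateField.adjoin k ((S.image Prod.snd : Finset K) : Set K)), ?_⟩
  simp only [map_sum, Algebra.TensorProduct.map_tmul, AlgHom.coe_id, id_eq, IntermediateField.val_mk]
  exact Finset.sum_attach S fun p => p.1 ⊗ₜ[k] p.2

/-- **`𝔭 · (A ⊗ₖ K)_𝔓 = 𝔪_{(A ⊗ₖ K)_𝔓}` for `K/k` SEPARABLE ALGEBRAIC OF ANY DEGREE** and any prime `𝔓` of `A ⊗ₖ K` over `𝔭 ⊂ A`: the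
closed fibre of `A_𝔭 → (A ⊗ₖ K)_𝔓` is a field. Reduction to finite sub-extensions: an element of `𝔓` comes from `𝔓₀ = 𝔓 ∩ (A ⊗ₖ K₀)`,
`K₀` finite separable, where `𝔭 (A ⊗ K₀)_𝔓₀ = 𝔓₀ (A ⊗ K₀)_𝔓₀`, and the localization map `(A ⊗ K₀)_𝔓₀ → (A ⊗ K)_𝔓` carries this over.
[cite: GrothendieckDieudonne1965, Prop. (4.6.1)] [cite: CossartJannsenSaito2020, Lemma 2.27 (1)] -/
theorem map_under_eq_maximalIdeal [Algebra.IsSeparable k K] (𝔓 : Ideal (A ⊗[k] K)) [𝔓.IsPrime] :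
    (𝔓.under A).map (algebraMap A (Localization.AtPrime 𝔓)) = maximalIdeal (Localization.AtPrime 𝔓) := by
  apply le_antisymm
  · rw [← Localization.AtPrime.map_eq_maximalIdeal, IsScalarTower.algebraMap_eq A (A ⊗[k] K) (Localization.AtPrime 𝔓),
      ← Ideal.map_map]
    exact Ideal.map_mono (Ideal.map_comap_le)
  · rw [← Localization.AtPrime.map_eq_maximalIdeal, Ideal.map_le_iff_le_comap]
    intro x hx
    rw [Ideal.mem_comap]
    obtain ⟨K₀, _, x₀, rfl⟩ := exists_intermediateField_fg_preimage (k := k) x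
    exact algebraMap_map_mem_map_under_of_finiteDimensional K₀.val 𝔓 x₀ hx

/-- **`(A ⊗ₖ K)_𝔓` is FLAT over `A_𝔭`** (for the canonical algebra structure): `A ⊗ₖ K` is flat over `A` (base change of the free `k`-module `K`),
its localization is flat over it, and flatness over `A` descends to the localization `A_𝔭`. [folklore; cite: CossartJannsenSaito2020, Lemma 2.27 (1)] -/
theorem flat_localization_tensorProduct (𝔓 : Ideal (A ⊗[k] K)) [𝔓.IsPrime] :
    letI := Localization.AtPrime.algebraOfLiesOver (𝔓.under A) 𝔓
    Module.Flat (Localization.AtPrime (𝔓.under A)) (Localization.AtPrime 𝔓) := by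
  letI := Localization.AtPrime.algebraOfLiesOver (𝔓.under A) 𝔓
  haveI : Module.Flat (A ⊗[k] K) (Localization.AtPrime 𝔓) := IsLocalization.flat _ 𝔓.primeCompl
  haveI : Module.Flat A (Localization.AtPrime 𝔓) := Module.Flat.trans A (A ⊗[k] K) (Localization.AtPrime 𝔓)
  exact (Module.flat_iff_of_isLocalization (Localization.AtPrime (𝔓.under A)) (𝔓.under A).primeCompl
    (Localization.AtPrime 𝔓)).mpr inferInstance

/-- **CJS Lemma 2.27 (1) for a separable ground-field extension: `H^{(0)}[(A ⊗ₖ K)_𝔓] = H^{(0)}[A_𝔭]`** for `K/k` separable algebraic of any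
degree, `A` and `A ⊗ₖ K` Noetherian (e.g. `A` essentially of finite type over `k`), `𝔓` a prime of `A ⊗ₖ K` over `𝔭`: the local map
`A_𝔭 → (A ⊗ₖ K)_𝔓` is flat with `𝔭 (A ⊗ₖ K)_𝔓 = 𝔪`, and the tree's `hilbertFun_eq_of_flat_of_map_maximalIdeal_eq` applies.
[cite: CossartJannsenSaito2020, Lemma 2.27 (1)] -/
theorem hilbertFun_localization_tensorProduct_eq [Algebra.IsSeparable k K] [IsNoetherianRing A] [IsNoetherianRing (A ⊗[k] K)]
    (𝔓 : Ideal (A ⊗[k] K)) [𝔓.IsPrime] :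
    Literature.RingTheory.HilbertSamuel.hilbertFun (Localization.AtPrime 𝔓) =
      Literature.RingTheory.HilbertSamuel.hilbertFun (Localization.AtPrime (𝔓.under A)) := by
  letI := Localization.AtPrime.algebraOfLiesOver (𝔓.under A) 𝔓
  haveI := flat_localization_tensorProduct (k := k) (A := A) 𝔓
  refine Literature.RingTheory.HilbertSamuel.hilbertFun_eq_of_flat_of_map_maximalIdeal_eq ?_
  rw [← Localization.AtPrime.map_eq_maximalIdeal, Ideal.map_map,
    ← IsScalarTower.algebraMap_eq A (Localization.AtPrime (𝔓.under A)) (Localization.AtPrime 𝔓)]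
  exact map_under_eq_maximalIdeal 𝔓

end Ring

end Summit.ResolutionOfSingularities.ResolutionOfSingularities.Theorems.SigmaMaxModificationsCorridor3.IsoTailsHS

end
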